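import Literature.NumberTheory.DiophantineGeometry.GenEllProjLine
import Mathlib.FieldTheory.Minpoly.Field
import HarnessLib

/-!
# [GenEll] Ex. 1.3 (i) "Galois-finite" sets and Prop. 1.4 (iv) (Northcott) for the projective line minus three points

S. Mochizuki, *Arithmetic elliptic curves in general position*, Math. J. Okayama Univ. 52 (2010)
[cite: MochizukiGenEll2010] (kurims manuscript, Feb. 2009), read on the page:

> Ex. 1.3 (i) (p. 5): "If `E ⊆ X(Q̄)` is a subset such that each `E^{≤d}` [where `d` ranges over the
> positive integers] is finite, then we shall say that `E` is Galois-finite."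
> Prop. 1.4 (iv) (p. 6): "Let `d` be a positive integer, `C ∈ ℝ`. Suppose further that the line bundle
> `L_ℚ` is ample on `X_ℚ`. Then the set of points `x ∈ X(Q̄)^{≤d}` [cf. Example 1.3, (i)] such that
> `ht_L̄(x) ≤ C` is finite." ("A proof of this well-known fact may, essentially, be found in [Silv1]",
> p. 7.)

For `(X, L) = (ℙ¹_ℚ, ω_P(C) ≅ 𝒪(1))` and the representative `NFPoint.ht` (normalised Weil height)
this is exactly **Northcott's theorem**: "There are only finitely many algebraic numbers of bounded
degree and bounded height" [cite: BombieriGubler2006, Thm 1.6.8].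

## Modelling (see `GenEllProjLine.lean`, "Points")

A point of `X(Q̄)` is presented as `(F, x)` and each Q̄-point has many (isomorphic) presentations, so
"finitely many points" must be counted through an invariant: we count **minimal polynomials over `ℚ`**
(`NFPoint.mpoly`; a Q̄-point of degree `e` and its `e` conjugates share one). `HasFinitelyManyPoints S`
says the points of `S` have finitely many minimal polynomials — for a set of Q̄-points this is
literally "finite up to Galois conjugacy", which for sets of bounded degree is "finite" up to the
factor `≤ d`; `IsGaloisFinite` is Ex. 1.3 (i). Northcott for `U_P(Q̄)^{≤d}` is the NAMED FACT
`northcott_UPle` (Mathlib has Northcott only for a FIXED number field,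
`NumberField.finite_setOf_logHeight₁_le`; the uniform-in-the-field version is not in Mathlib).

Also recorded, PROVED: the three functions of [GenEll] §1 are nonnegative on our model
(`ht_nonneg`, `logDiff_nonneg`, `logCond_nonneg`) — used downstream to discard exceptional sets on
which `ht` is bounded ([IUTchIV] Cor. 2.2 (ii): "The function `log(q^∀)` … is `≤ H_unif·… + H_K` on
`Exc_d`").
-/

noncomputable section

open NumberField IsDedekindDomain

namespace Literature.NumberTheory.DiophantineGeometry.GenEll

namespace NFPoint

/-- The minimal polynomial over `ℚ` of (the coordinate of) a presented point; a Q̄-point and its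
Galois conjugates, in all their presentations, have the same one. [cite: MochizukiGenEll2010, Ex 1.3 (i) p.5] -/
def mpoly (P : NFPoint) : Polynomial ℚ := minpoly ℚ P.x

/-- The degree of the minimal polynomial of a minimally presented point is the degree `[F:ℚ]` of the
point (`F = ℚ(x)`). [cite: MochizukiGenEll2010, Def 1.5 (i) p.8] -/
theorem natDegree_mpoly (P : NFPoint) (hP : P.IsMinimal) : P.mpoly.natDegree = P.degree := by
  have hint : IsIntegral ℚ P.x := Algebra.IsIntegral.isIntegral P.x
  rw [mpoly, degree, ← IntermediateField.adjoin.finrank hint]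
  have h := hP
  unfold IsMinimal at h
  rw [h]
  exact IntermediateField.finrank_top'

/-- The height representative is nonnegative: `h_F(x) = Σ_v log⁺ ‖x‖_v ≥ 0`.
[cite: MochizukiGenEll2010, Prop 1.4 (ii) p.6] -/
theorem ht_nonneg (P : NFPoint) : 0 ≤ P.ht := by
  unfold ht
  refine mul_nonneg (inv_nonneg.mpr (Nat.cast_nonneg _)) ?_
  rw [Height.logHeight₁_eq_log_mulHeight₁]
  exact Real.log_nonneg (Height.one_le_mulHeight₁ _)

/-- The log-different is nonnegative (`N(𝔡_F) ≥ 1`; "`δ_x` … effective", Def. 1.5 (iii)).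
[cite: MochizukiGenEll2010, Def 1.5 (iii) p.8] -/
theorem logDiff_nonneg (P : NFPoint) : 0 ≤ P.logDiff := by
  unfold logDiff
  refine mul_nonneg (inv_nonneg.mpr (Nat.cast_nonneg _)) (Real.log_nonneg ?_)
  have h : Ideal.absNorm (differentIdeal ℤ (𝓞 P.F)) ≠ 0 := by
    rw [ne_eq, Ideal.absNorm_eq_zero_iff]
    exact differentIdeal_ne_bot
  exact_mod_cast Nat.one_le_iff_ne_zero.mpr h

/-- The log-conductor is nonnegative (`(D_x)_red` is effective, Def. 1.5 (iv)).
[cite: MochizukiGenEll2010, Def 1.5 (iv) p.8] -/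
theorem logCond_nonneg (P : NFPoint) : 0 ≤ P.logCond := by
  rw [logCond_eq]
  refine mul_nonneg (inv_nonneg.mpr (Nat.cast_nonneg _)) (Real.log_nonneg ?_)
  have h : radicalNorm P.x (1 - P.x) 1 ≠ 0 := by
    unfold radicalNorm
    rw [finprod_mem_def]
    classical
    refine finprod_ne_zero fun v => ?_
    rw [Set.mulIndicator_apply]
    split_ifs
    · rw [ne_eq, Ideal.absNorm_eq_zero_iff]
      exact v.ne_bot
    · exact one_ne_zero
  exact_mod_cast Nat.one_le_iff_ne_zero.mpr h

end NFPoint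

/-- "Finitely many points" for a set of presented points, counted through minimal polynomials:
the set of minimal polynomials of the points of `S` is finite (for Q̄-points: finitely many Galois
orbits). [cite: MochizukiGenEll2010, Ex 1.3 (i) p.5] -/
def HasFinitelyManyPoints (S : Set NFPoint) : Prop := (NFPoint.mpoly '' S).Finite

/-- [GenEll] Ex. 1.3 (i): `E ⊆ X(Q̄)` is **Galois-finite** if each `E^{≤d}` is finite.
[cite: MochizukiGenEll2010, Ex 1.3 (i) p.5] -/
def IsGaloisFinite (S : Set NFPoint) : Prop := ∀ d : ℕ, HasFinitelyManyPoints (S ∩ UPle d)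

/-- A subset of a set with finitely many points has finitely many points.
[cite: MochizukiGenEll2010, Ex 1.3 (i) p.5] -/
theorem HasFinitelyManyPoints.mono {S T : Set NFPoint} (h : HasFinitelyManyPoints T) (hST : S ⊆ T) :
    HasFinitelyManyPoints S :=
  Set.Finite.subset h (Set.image_mono hST)

/-- NAMED FACT — **[GenEll] Prop. 1.4 (iv) for `(ℙ¹_ℚ, ω_P(C) ≅ 𝒪(1))` = Northcott's theorem**: for
every positive integer `d` and `C ∈ ℝ`, the points of `U_P(Q̄)^{≤d}` of height `≤ C` are finitely many
(finitely many minimal polynomials: "There are only finitely many algebraic numbers of bounded degree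
and bounded height", Bombieri–Gubler Thm. 1.6.8, via the Mahler measure of the minimal polynomial).
Mathlib has the one-field-at-a-time form `NumberField.finite_setOf_logHeight₁_le`; the uniform form is this
named fact. [cite: BombieriGubler2006, Thm 1.6.8] -/
def northcott_UPle : Prop :=
  ∀ (d : ℕ) (C : ℝ), HasFinitelyManyPoints {P | P ∈ UPle d ∧ P.ht ≤ C}

end Literature.NumberTheory.DiophantineGeometry.GenEll

end
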